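import Summits.CriticalPhenomena.Ising3DConformalLimit.Theorems.HyperoctahedralRPExistsScaleCovariantLimitFoldedCurrentWallRepulsionIffDoubling
import Summits.CriticalPhenomena.Ising3DConformalLimit.Theorems.HyperoctahedralRPExistsScaleCovariantLimitFoldedCurrentIdentity
import Summits.CriticalPhenomena.Ising3DConformalLimit.Theorems.HyperoctahedralRPExistsScaleCovariantLimitFunnelThroughDoubling
import HarnessLib

/-!
# Line `folded-current-repulsion` (crux `ExistsScaleCovariantLimit`, stmt-CriticalPhenomena-1981): the engine ⟺ item 6150, unconditionally

Lead `prover-line-stmt-CriticalPhenomena-1981-c11-0`. With Aizenman's folded random-current identity on the boxes now PROVED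
(`stub_foldedIdentity`, wave-1 stub file `…FoldedCurrentIdentity.lean`, p138063), the conditional certification of
`…FoldedCurrentWallRepulsionIffDoubling.lean` (p137922) becomes unconditional:

* `wallRepulsion_iff_twoPointDoubling` : `WallRepulsion ↔ MirrorHoelderCompactness.TwoPointDoubling` (registered sub-goal) — the
  line's load-bearing stub F2 IS item stmt-CriticalPhenomena-6150, i.e. Aizenman–Duminil-Copin 2021 Remark 5.10's log-free axial gradient
  bound, written as a wall-avoidance estimate for ONE sourced random current of the nearest-neighbour model at `β_c(3)`;
* `smms_deficit_eq_lim_avoidance` : the infinite-volume SMMS DEFICIT is the limit of the box avoidance probabilities,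
  `1 − g(k+2)/g(k) = lim_L (1 − P^{xy}_{Λ_L,β_c}[y ⟷ 𝕏])` (`x = −(k+1)e₀`, `y = −e₀`; Aizenman 2025 §15, eq. after Thm 15.1);
* `wallRepulsion_of_crux` : the crux implies F2 (through `Funnel.twoPointDoubling_of_crux`), so F2 is NECESSARY for every existence proof —
  and `not_crux_of_not_wallRepulsion` : a refutation of wall repulsion refutes the crux (and items 6153, 14454, 5955, 4658 with it,
  `Funnel.all_fail_of_not_twoPointDoubling`).

References: M. Aizenman, Math. Phys. Anal. Geom. 28 (2025) 32, Thm 14.2 and §15; M. Aizenman, H. Duminil-Copin, Ann. Math. 194 (2021), Remark 5.10.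
-/

noncomputable section

open Filter Topology
open Literature.Probability.LatticeModels
open Summit.CriticalPhenomena.Ising3DConformalLimit.Theses
open Classical

namespace Summit.CriticalPhenomena.Ising3DConformalLimit.Cruxes.ExistsScaleCovariantLimit.FoldedCurrentRepulsion

/-- **Registered sub-goal: the engine of the line IS item 6150.** `WallRepulsion ↔ MirrorHoelderCompactness.TwoPointDoubling`,
unconditionally (F1 discharged by `stub_foldedIdentity`). -/
theorem wallRepulsion_iff_twoPointDoubling : WallRepulsion ↔ MirrorHoelderCompactness.TwoPointDoubling :=
  wallRepulsion_iff_twoPointDoubling_of_foldedIdentity stub_foldedIdentity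

/-- **The SMMS deficit is the limiting wall-avoidance probability** (Aizenman 2025, §15): for every `k`,
`1 − P^{xy}_{Λ_L,β_c}[y ⟷ 𝕏] → 1 − g(k+2)/g(k)` as `L → ∞`, with `x = −(k+1)e₀`, `y = −e₀`, `g(n) = ⟨σ₀σ_{ne₀}⟩_{β_c(3)}`. -/
theorem smms_deficit_eq_lim_avoidance (k : ℕ) :
    Tendsto (fun L : ℕ => 1 - foldHitProb L (criticalBeta 3) (Pi.single 0 (-((k : ℤ) + 1))) (Pi.single 0 (-1))) atTop
      (𝓝 (1 - criticalTwoPoint 3 (Pi.single 0 ((k + 1 + 1 : ℕ) : ℤ)) / criticalTwoPoint 3 (Pi.single 0 (k : ℤ)))) :=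
  tendsto_const_nhds.sub (tendsto_foldHitProb stub_foldedIdentity k)

/-- **The infinite-volume folded identity at `β_c` along the axis**: the box hitting probabilities converge to the axis ratio,
`P^{xy}_{Λ_L,β_c}[y ⟷ 𝕏] → g(k+2)/g(k)` (Aizenman 2025, Thm 14.2 and the Remark after its proof: "the infinite volume version … can
be deduced through the infinite volume limit of the finite volume states"). -/
theorem foldHitProb_tendsto_axis_ratio (k : ℕ) :
    Tendsto (fun L : ℕ => foldHitProb L (criticalBeta 3) (Pi.single 0 (-((k : ℤ) + 1))) (Pi.single 0 (-1))) atTop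
      (𝓝 (criticalTwoPoint 3 (Pi.single 0 ((k + 1 + 1 : ℕ) : ℤ)) / criticalTwoPoint 3 (Pi.single 0 (k : ℤ)))) :=
  tendsto_foldHitProb stub_foldedIdentity k

/-- **Wall repulsion is NECESSARY for the crux**: `ExistsScaleCovariantLimit → WallRepulsion`
(crux ⟹ item 6150 by `Funnel.twoPointDoubling_of_crux`, p131624, then 6150 ⟹ F2). -/
theorem wallRepulsion_of_crux
    (h : Summit.CriticalPhenomena.Ising3DConformalLimit.Theses.HyperoctahedralRP.ExistsScaleCovariantLimit) : WallRepulsion :=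
  wallRepulsion_iff_twoPointDoubling.2 (Funnel.twoPointDoubling_of_crux h)

/-- **A refutation of wall repulsion refutes the crux** (contrapositive; the disprover's entry point on this line). -/
theorem not_crux_of_not_wallRepulsion (h : ¬ WallRepulsion) :
    ¬ Summit.CriticalPhenomena.Ising3DConformalLimit.Theses.HyperoctahedralRP.ExistsScaleCovariantLimit :=
  fun hc => h (wallRepulsion_of_crux hc)

end Summit.CriticalPhenomena.Ising3DConformalLimit.Cruxes.ExistsScaleCovariantLimit.FoldedCurrentRepulsion

end
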